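import Summits.HodgeConjecture.HodgeConjecture.Theorems.PadicSemiregularLiftHodgeAbelianVarietiesPrymDefs
import Summits.HodgeConjecture.HodgeConjecture.Theorems.PadicSemiregularLiftHodgeAbelianVarietiesStubVhcFromCMFibre
import Summits.HodgeConjecture.HodgeConjecture.Theorems.HeckePrymWeilHeckePrymAnchorsGlobalClassOfSection
import Summits.HodgeConjecture.HodgeConjecture.Theorems.HeckePrymWeilHeckePrymAnchorsRationalAlongSection
import Literature.AlgebraicGeometry.HodgeTheory.MotivatedClassesDeformationLeaves
import Literature.AlgebraicGeometry.HodgeTheory.WeilClasses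
import Literature.AlgebraicGeometry.HodgeTheory.HodgeLocus
import Literature.AlgebraicGeometry.HodgeTheory.GlobalInvariantCycles
import Literature.AlgebraicGeometry.Motives.FamiliesVHS
import Literature.AlgebraicGeometry.Motives.HyperbolicWeilType
import Literature.AlgebraicGeometry.Motives.Varieties
import Literature.AlgebraicGeometry.HodgeTheory.WeilClassesIsogenyDescent
import Literature.AlgebraicGeometry.HodgeTheory.WeilClassesSixfoldsProofs
import Literature.AlgebraicGeometry.HodgeTheory.AlgebraicClassesCupAbelianVariety
import Literature.AlgebraicGeometry.HodgeTheory.LefschetzOneOne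
import Literature.AlgebraicGeometry.HodgeTheory.FermatHypersurfaceReduction
import Literature.AlgebraicGeometry.HodgeTheory.HodgeTypeExteriorProduct
import Literature.AlgebraicGeometry.HodgeTheory.HodgeTypeConjugation
import Literature.AlgebraicGeometry.Motives.AbelianVarietyCohomologyExteriorH1
import Literature.AlgebraicGeometry.Motives.HyperbolicWeilTypeProduct
import Literature.AlgebraicTopology.SingularHomology.CupProductProofs
import Literature.NumberTheory.Transcendental.DeRhamTheoremMultiplicative
import Literature.AlgebraicGeometry.HodgeTheory.WeilFamilyReach

/-!
# Crux `HodgeAbelianVarieties` (stmt-HodgeConjecture-1333), line `prym-canonical-z3-split-seeds` — stub `stub_spreadClosing`: the conditional reduction of the closing infrastructure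

The registered stub `stub_spreadClosing : SpreadClosing`,
`SpreadClosing := PrymSpread → Stubs.WeilAlgebraicSplitHyperplane 4 3` (skeleton
`Cruxes/HodgeAbelianVarieties/Lines/prym_canonical_z3_split_seeds.lean`, STUB 3; vocabulary
`Theorems/PadicSemiregularLiftHodgeAbelianVarietiesPrymDefs`), is PRINT-LEVEL INFRASTRUCTURE: spread of
ONE seed class at ONE split genus-5 Schoen–Prym `√-3` eightfold closes the whole split `ℚ(√-3)`
eightfold sector. This file lands its CONDITIONAL REDUCTION
`spreadClosing_of_weilFamilyReach` to FIVE named facts, everything else being theorems of the tree: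

* (R) `weilFamilyReach_hyperbolic` — NEW NAMED FACT (inline, `[file …/WeilFamilyReach]`): Deligne's
  polarized Weil family (proof of [Deligne1982HodgeCycles, Thm. 4.8], pp. 47–52; van Geemen 5.8–5.11)
  THROUGH a given hyperbolic `(P, ψ₀, h_K)` — embedded smooth projective family of `√-d` abelian
  `2n`-folds over a smooth irreducible quasi-projective base, `P ≅ 𝒳_{s₀}` — with (a) the relative
  polarization class `H ∈ H²(𝒳(ℂ); ℂ)` (fibrewise rational `(1,1)`, `e'^*(H|_{s₀}) = h_K`), (b) the
  FLAT section `σ` of `R^{2n} f_* ℂ` through any non-zero Weil class `w` of `P` (monodromy in `SU`,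
  `det_K = 1`), of Hodge type `(n,n)` on every fibre (all fibres are of Weil type `(n,n)`, Prop. 4.4),
  and (c) REACH: every hyperbolic `(A, φ, h_K(A))` of the same `(2n, d)` is `K`-isogenous to a fibre
  `𝒳_{s₁} ≅ A'` (hyperbolic `K`-Hermitian spaces of equal rank are isometric — Landherr — and the
  complex structure of `A` transported to `H₁(P, ℝ)` is a point of the same connected Hermitian
  domain), `σ(s₁)` being a NON-ZERO class of the Weil plane of `(A', φ')`. Shape and carriers copy the
  accepted sibling `deligne1982_weilFamily_hodgeWeilSection` (`Literature/…/WeilFamilyFlatSections`).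
* `deligne_globalInvariantCycles` (Hodge II 4.1.1) and `Hironaka1964_smoothCompactification` — through
  the tree's PROVED W-engine `stub_globalClassOfSection` (the global class `W₀` of the flat section) and
  `stub_rationalAlongSection` (rationality along a flat section, PROVED);
* `charlesSchnell_algebraicityLocus_iUnion_closed` (relative Hilbert schemes) — through the tree's PROVED
  spreading step `map_fiberι_mem_algebraicClasses_of_isOpen` (Baire in `S(ℂ)` + irreducibility);
* `lefschetzOneOne_rational` — the polarization class at `s₁` is a divisor class, so `H|_{s₁}⁴` is
  algebraic (`AbelianVariety.cupProduct_mem_algebraicClasses_one`, PROVED).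

PROOF of `spreadClosing_of_weilFamilyReach` (print, steps (i)–(v) of the stub's docstring): unpack
`PrymSpread` to `(P, ψ₀, e, a, w, c)`; (i)+(ii) the reach family of (R) with `W := W₀ + c • H⁴`
(`W₀` the global class of `σ`): `e'^*(W|_{s₀}) = w + c h_K⁴`, `W|_s` rational (flat transport of the
rational `w + c h_K⁴`) and of type `(4,4)` (`σ` is, and `H|_s⁴` is — cup products add Hodge types, de
Rham, PROVED) on every fibre, so the `∀`-clause of `PrymSpread` applies: `W|_t` algebraic on a
non-empty open `U ⊆ S(ℂ)`; (iii) hence on EVERY fibre; (iv) on `A' ≅ 𝒳_{s₁}`: `e₁^*(W|_{s₁})` and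
`e₁^*(H|_{s₁})⁴` are algebraic, so is `e₁^*σ(s₁) = e₁^*(W|_{s₁}) - c·e₁^*(H|_{s₁})⁴`, a NON-ZERO class
of `weilClassesOf A' φ' 4 3`; one class suffices
(`weilClassesOf_le_algebraicClasses_iff_exists_ne_zero_of_dim_eq`, PROVED); (v) isogeny descent to
`(A, φ)` (`mem_algebraicClasses_of_isogeny_of_mem_weilClassesOf`, PROVED). No `sorry`; the five facts
enter only as hypotheses. The lead glues `SpreadClosing` from this theorem.
-/

-- single-problem summit (Problem = Summit): the mandated namespace repeats `HodgeConjecture`.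
set_option linter.dupNamespace false

noncomputable section

open CategoryTheory
open Literature.AlgebraicGeometry Literature.AlgebraicGeometry.Motives
  Literature.AlgebraicGeometry.HodgeTheory
open Literature.AlgebraicTopology.SingularHomology

/-! ### The named fact: Deligne's polarized Weil family through a hyperbolic point, with reach
(stated in the Literature namespace, fully qualified; relocated by the gate to
`Literature/AlgebraicGeometry/HodgeTheory/WeilFamilyReach.lean`) -/

namespace Literature.AlgebraicGeometry.HodgeTheory

end Literature.AlgebraicGeometry.HodgeTheory

namespace Summit.HodgeConjecture.HodgeConjecture.Cruxes.HodgeAbelianVarieties.PrymCanonicalZ3SplitSeeds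

open AlgebraicGeometry MonoidalCategory CartesianMonoidalCategory Literature.Geometry.Kaehler
open Summit.HodgeConjecture.HodgeConjecture.Cruxes.HodgeAbelianVarieties.EStepSecantInduction

local notation3 (prettyPrint := false) "Res[" f ", " s ", " k ", " A "]" =>
  complexBetti.map (Motives.fiberι f s) k A

/-! ### Bookkeeping for `h⁴ = pow4 h` -/

/-- `pow4` commutes with pull-backs: `g^*(h⁴) = (g^*h)⁴` (naturality of the iterated Lefschetz
operator, `lefschetzPow_map`). -/
theorem spreadClosing_pow4_map {X Y : SchemeOver ℂ} (g : X ⟶ Y) (h : complexBetti Y 2) :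
    complexBetti.map g (2 * 4) (pow4 h) = pow4 (complexBetti.map g 2 h) :=
  lefschetzPow_map (Motives.AlgPoints.mapContinuous (L := ℂ) g) h 3 2 h

/-- `h⁴ = h ⌣ (h ⌣ (h ⌣ h))` (unfolding the third Lefschetz iterate). -/
theorem spreadClosing_pow4_eq_cupProduct {X : SchemeOver ℂ} (h : complexBetti X 2) :
    pow4 h = cupProduct (show 2 + 6 = 8 by norm_num) h
      (cupProduct (show 2 + 4 = 6 by norm_num) h (cupProduct (show 2 + 2 = 4 by norm_num) h h)) :=
  rfl

/-- On a smooth projective `X`, the fourth power of a class of Hodge type `(1,1)` is of type `(4,4)`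
(cup products add Hodge types — de Rham's theorem, PROVED in the tree:
`cupPreservesHodgeType_of_multiplicative_deRham`). -/
theorem spreadClosing_pow4_isOfHodgeType {m : ℕ} {X : SchemeOver ℂ} (hX : IsSmoothProjective m X)
    {h : complexBetti X 2} (hh : IsOfHodgeType m X 2 1 1 h) : IsOfHodgeType m X (2 * 4) 4 4 (pow4 h) := by
  have hcup : CupPreservesHodgeType m X :=
    cupPreservesHodgeType_of_multiplicative_deRham
      (fun E _ _ _ ↦ Literature.NumberTheory.Transcendental.exists_deRhamIsoFamily_holds E) hX
  -- (the intermediate types are read off by `have … := …`; stating them up front makes the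
  -- elaborator unfold `IsOfHodgeType` while unifying `1 + 1` with `2`)
  have h2 := hcup (show 2 + 2 = 4 by norm_num) hh hh
  have h3 := hcup (show 2 + 4 = 6 by norm_num) hh h2
  have h4 := hcup (show 2 + 6 = 8 by norm_num) hh h3
  have h4' : IsOfHodgeType m X 8 4 4 (cupProduct (show 2 + 6 = 8 by norm_num) h
      (cupProduct (show 2 + 4 = 6 by norm_num) h (cupProduct (show 2 + 2 = 4 by norm_num) h h))) := h4
  exact h4'

/-- On a complex abelian variety, the fourth power of a divisor class is algebraic:
`h ∈ N¹H² ⟹ h⁴ ∈ N⁴H⁸` (three applications of the tree's PROVED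
`AbelianVariety.cupProduct_mem_algebraicClasses_one`, Voisin II Prop. 9.20, after graded commutativity
`h ⌣ y = y ⌣ h` in even degree). -/
theorem spreadClosing_pow4_mem_algebraicClasses (B : AbelianVariety ℂ) {h : complexBetti B.X 2}
    (hh : h ∈ algebraicClasses B.X 1) : pow4 h ∈ algebraicClasses B.X 4 := by
  have step : ∀ (l : ℕ) (hl : 2 + 2 * l = 2 * (l + 1)) (y : complexBetti B.X (2 * l)),
      y ∈ algebraicClasses B.X l → cupProduct hl h y ∈ algebraicClasses B.X (l + 1) := by
    intro l hl y hy
    rw [cupProduct_gradedComm_holds ℂ (ComplexPoints B.X) hl (two_mul_add_two_mul l 1) h y,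
      Even.neg_one_pow (even_two_mul _), one_smul]
    exact AbelianVariety.cupProduct_mem_algebraicClasses_one B hy hh
  rw [spreadClosing_pow4_eq_cupProduct]
  exact step 3 _ _ (step 2 _ _ (step 1 _ _ hh))

/-! ### The conditional reduction of `stub_spreadClosing` -/

/-- **`SpreadClosing` (= `PrymSpread → Stubs.WeilAlgebraicSplitHyperplane 4 3`) from the Weil-family
reach fact and four named facts of the tree** (registered helper `spreadClosing_of_weilFamilyReach` of
stmt-HodgeConjecture-1333; the print proof (i)–(v) of STUB 3 of line `prym-canonical-z3-split-seeds`).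
Given the `PrymSpread` witness `(P, ψ₀, e, a, w, c)` and a hyperbolic `(A, φ, e_A, a_A)`, `dim A = 8`,
`φ² = -3`: the reach family `f : 𝒳 → S` of `weilFamilyReach_hyperbolic` through `P` with the flat
Weil section `σ` through `w` and the polarization class `H`; `W := W₀ + c • H⁴`, `W₀` the global class of
`σ` (`stub_globalClassOfSection`: partie fixe + Hironaka), restricts at `s₀` to `e'^{-1*}(w + c h_K⁴)`,
is fibrewise rational (`stub_rationalAlongSection`) and of type `(4,4)`; the `∀`-clause of `PrymSpread`
gives a non-empty open set of algebraicity, the spreading step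
(`map_fiberι_mem_algebraicClasses_of_isOpen`: Hilbert-scheme fact + Baire + irreducibility) all of
`S(ℂ)`; at the reach point `s₁`, `e₁^*σ(s₁) = e₁^*(W|_{s₁}) - c·(e₁^*H|_{s₁})⁴` is algebraic
(Lefschetz `(1,1)` for `e₁^*H|_{s₁}`, `spreadClosing_pow4_mem_algebraicClasses`) and is a non-zero
Weil class of `(A', φ')`, so the Weil plane of `A'` is algebraic (one class suffices), and isogeny
descent along `(u, v)` gives
`WeilAlgebraicFor 4 3 A φ`. CONDITIONAL on the five hypotheses; introduces nothing else. -/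
theorem spreadClosing_of_weilFamilyReach :
    Literature.AlgebraicGeometry.HodgeTheory.weilFamilyReach_hyperbolic → deligne_globalInvariantCycles → Hironaka1964_smoothCompactification →
      charlesSchnell_algebraicityLocus_iUnion_closed → lefschetzOneOne_rational →
      PrymSpread → Stubs.WeilAlgebraicSplitHyperplane 4 3 := by
  rintro hR hD hHir hCS hL ⟨P, ψ₀, e, a, w, c, hP, ha, ha0, hhyp, hw, hw0, hrat, hspread⟩ A φ eA aA hA hφ
    haA haA0 hhypA
  -- `(P, ψ₀)`: an abelian eightfold with `ψ₀² = -3`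
  have hP8 : P.dim = 2 * 4 := by
    obtain ⟨-, -, -, -, -, -, -, -, -, -, -, h8⟩ := hP
    exact h8
  have hψ : ψ₀ ≫ ψ₀ = -(3 • 𝟙 P) := comp_self_of_isSchoenPrymPair hP
  have hhyp' : IsHyperbolicWeilType P ψ₀ 4 (((3 : ℕ) : ℂ) • complexBetti.map e.ι 2 a +
      complexBetti.map ψ₀.hom.hom.hom 2 (complexBetti.map e.ι 2 a)) := by
    rw [Nat.cast_ofNat]; exact hhyp
  -- (i)+(ii)+(iv): the reach family through `P`, its flat Weil section through `w`, the polarization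
  -- class, and the fibre `A' ≅ 𝒳_{s₁}` `K`-isogenous to `A`
  obtain ⟨𝒳, S, f, s₀, s₁, e', A', φ', e₁, σ, H, hf, hι, hirr, hSm, hSqp, hfib, hH, hHs₀, hσ, hpt, hσH,
      hσ₀, hA', hφ', ⟨u, v, m, hm, huv, hflat, hv⟩, w₁, hσ₁, hw₁W, hw₁0⟩ :=
    hR 4 3 (by norm_num) (by norm_num) P ψ₀ e a hP8 hψ ha ha0 hhyp' w hw hw0 A φ eA aA hA hφ haA haA0
      hhypA
  rw [Nat.cast_ofNat] at hHs₀
  have h𝒳qp : IsQuasiProjectiveOver 𝒳 := by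
    obtain ⟨N, ι, hιc, -⟩ := hι
    haveI := hιc
    exact IsQuasiProjectiveOver.of_isClosedImmersion_projectiveSpace_tensor ι hSqp
  -- the global class `W₀` of the flat Weil section (partie fixe + Hironaka, W-engine PROVED)
  obtain ⟨W₀, hW₀⟩ :=
    Summit.HodgeConjecture.HodgeConjecture.Theorems.HeckePrymWeilLine.stub_globalClassOfSection hD hHir
      f (2 * 4) (2 * 4) hf hι hSm hSqp hirr σ hσ hpt
  have hcls : ∀ (s : ComplexPoints S) (y : complexBetti (fiberOver f s) (2 * 4)),
      σ s = ⟨s, y⟩ → Res[f, s, 2 * 4, W₀] = y := fun s y hy =>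
    (FiberClass.mk_eq_mk_iff _ _).1 ((hW₀ s).symm.trans hy)
  -- the global class `W := W₀ + c • H⁴` and its fibre restrictions
  set W : complexBetti 𝒳 (2 * 4) := W₀ + c • pow4 H with hWdef
  have hWres : ∀ t, Res[f, t, 2 * 4, W] = Res[f, t, 2 * 4, W₀] + c • pow4 (Res[f, t, 2, H]) := by
    intro t
    rw [hWdef, map_add, map_smul, spreadClosing_pow4_map]
  -- anchor: `e'^*(W|_{s₀}) = w + c • h_K⁴`
  have hWs₀ : complexBetti.map e'.hom (2 * 4) (Res[f, s₀, 2 * 4, W]) = w + c • pow4 (symHyp ψ₀ e a) := by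
    rw [hWres, map_add, map_smul, spreadClosing_pow4_map, hcls s₀ _ hσ₀, hHs₀]
    congr 1
    exact map_hom_map_inv_apply e' (2 * 4) w
  -- fibrewise rationality of `W` (flat transport of the rational class `w + c • h_K⁴`)
  have hrat₀ : IsRationalClass (Res[f, s₀, 2 * 4, W]) := by
    have key : Res[f, s₀, 2 * 4, W] =
        complexBetti.map e'.inv (2 * 4) (complexBetti.map e'.hom (2 * 4) (Res[f, s₀, 2 * 4, W])) :=
      (map_hom_map_inv_apply e'.symm (2 * 4) _).symm
    rw [key, hWs₀]
    exact hrat.pullback _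
  have hWrat : ∀ s, IsRationalClass (Res[f, s, 2 * 4, W]) := fun s =>
    Summit.HodgeConjecture.HodgeConjecture.Theorems.HeckePrymWeilLine.stub_rationalAlongSection f (2 * 4)
      (2 * 4) hf hSm hSqp hirr (globalSection f (2 * 4) W) (continuous_globalSection f _ W)
      (fun _ => rfl) s₀ hrat₀ s
  -- fibrewise Hodge type `(4,4)` of `W`
  have hWH : ∀ s, IsOfHodgeType (2 * 4) (fiberOver f s) (2 * 4) 4 4 (Res[f, s, 2 * 4, W]) := by
    intro s
    have hX := hf.isSmoothProjective s
    have h1 : IsOfHodgeType (2 * 4) (fiberOver f s) (2 * 4) 4 4 (Res[f, s, 2 * 4, W₀]) := by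
      have h := hσH s
      rw [hW₀ s] at h
      exact h
    rw [hWres]
    exact h1.add hX ((spreadClosing_pow4_isOfHodgeType hX (hH s).2).smul c)
  -- (iii) SPREAD: the `∀`-clause of `PrymSpread` along the reach family, then Baire + irreducibility
  obtain ⟨U, hU, hUne, hUalg⟩ := hspread 𝒳 S f s₀ e' W H hf h𝒳qp hSqp hSm hirr hfib
    (fun s => ⟨hWrat s, hWH s⟩) hH hWs₀ hHs₀
  have hall : ∀ t, Res[f, t, 2 * 4, W] ∈ algebraicClasses (fiberOver f t) 4 :=
    SubtorusGalleryBlochSeeds.Stubs.map_fiberι_mem_algebraicClasses_of_isOpen hCS f h𝒳qp hSqp hSm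
      hirr hf W hU hUne hUalg
  -- (iv) at the reach point: `e₁^*σ(s₁)` is a non-zero ALGEBRAIC Weil class of `(A', φ')`
  have hX₁ := hf.isSmoothProjective s₁
  have hA'sp : IsSmoothProjective (2 * 4) A'.X := isSmoothProjective_of_dim_eq' hA'
  have halg₁ : complexBetti.map e₁.hom (2 * 4) (Res[f, s₁, 2 * 4, W]) ∈ algebraicClasses A'.X 4 :=
    mem_algebraicClasses_map_of_iso hX₁ hA'sp e₁ (hall s₁)
  have hH₁ : complexBetti.map e₁.hom 2 (Res[f, s₁, 2, H]) ∈ algebraicClasses A'.X 1 :=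
    hL hA'sp _ ((hH s₁).1.pullback _) ((hH s₁).2.map_of_iso e₁)
  have hw₁eq : complexBetti.map e₁.hom (2 * 4) w₁ =
      complexBetti.map e₁.hom (2 * 4) (Res[f, s₁, 2 * 4, W]) -
        c • pow4 (complexBetti.map e₁.hom 2 (Res[f, s₁, 2, H])) := by
    rw [hWres, map_add, map_smul, spreadClosing_pow4_map, hcls s₁ w₁ hσ₁, add_sub_cancel_right]
  have hw₁alg : complexBetti.map e₁.hom (2 * 4) w₁ ∈ algebraicClasses A'.X 4 := by
    rw [hw₁eq]
    exact Submodule.sub_mem _ halg₁ (Submodule.smul_mem _ c (spreadClosing_pow4_mem_algebraicClasses A' hH₁))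
  -- one class suffices: the whole Weil plane of `(A', φ')` is algebraic
  have hplane : weilClassesOf A' φ' 4 3 ≤ algebraicClasses A'.X 4 :=
    (weilClassesOf_le_algebraicClasses_iff_exists_ne_zero_of_dim_eq
      abelianVarietyCohomologyExteriorH1_holds hA' (by norm_num) (by norm_num) hφ').2
      ⟨_, hw₁W, hw₁alg, hw₁0⟩
  -- (v) ISOGENY DESCENT to `(A, φ)`
  have hAsp : IsSmoothProjective (2 * 4) A.X := isSmoothProjective_of_dim_eq' hA
  obtain ⟨MB⟩ := nonempty_hodgeModel_holds (n := 2 * 4) (X := A'.X) hA'sp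
  haveI : Flat u.hom.hom.hom.left := hflat
  intro x hxW hxr hxH
  exact mem_algebraicClasses_of_isogeny_of_mem_weilClassesOf hAsp hA'sp MB u v hv hm huv
    (fun y _ _ hy => hplane hy) hxr hxH hxW

end Summit.HodgeConjecture.HodgeConjecture.Cruxes.HodgeAbelianVarieties.PrymCanonicalZ3SplitSeeds

end
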